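import Literature.Analysis.ValidatedNumerics.MultiPrecisionInterval
import HarnessLib

/-!
# Kernel-checked Riemann enclosures of moments `∫₀^∞ tⁿ g(t) dt` of a decreasing density

Topic `Literature/Analysis/ValidatedNumerics`: a generic certificate checker in the style of this
directory (`ExpSumEnclosure.lean`, `KernelData.lean`, …), built on the multi-precision interval
engine `MultiPrecisionInterval.lean` (`NumericsMP.MI`, membership `MI.mem S x I` at a scale `S`).

The mathematics is the zeroth-order (monotone) Riemann enclosure: if `g ≥ 0` is antitone on `[0, ∞)`
then on every cell `[a, b] ⊆ [0, ∞)`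
`g(b) · ∫_a^b tⁿ dt ≤ ∫_a^b tⁿ g(t) dt ≤ g(a) · ∫_a^b tⁿ dt`, the weight `(b^{n+1} − a^{n+1})/(n+1)`
being exact.  On the grid `t_i = i/q` the weights are the integers `(i+1)^{n+1} − i^{n+1}` over the
common denominator `q^{n+1} (n+1)`, so that, given integer enclosures `⟨lo_i, hi_i⟩` of `g(t_i) · S`
(an ORACLE `enc : ℕ → Option MI` supplied and proved sound by the user), the lower and upper Riemann
sums over a block are ONE exact integer fold (`sumsZ`; `sumsZ₃` shares the oracle pass between
three exponents) and a claimed rational enclosure of `∫_{i₀/q}^{(i₀+len)/q} tⁿ g` is a closed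
Boolean term (`checkBlock₃`), evaluated by the kernel (`decide +kernel`) and turned into a theorem
by `encl_of_checkBlock₃`.  Blocks are glued with `integral_add_adjacent` / `bounds_of_chunkBounds`
(so that no single kernel evaluation is long), and the improper integral is reached with
`le_integral_Ioi` / `integral_Ioi_le_add` from a user-proved tail bound.

## Main definitions and results
(namespace `Literature.Analysis.ValidatedNumerics.MonotoneQuadrature`)

* `cellWeight`, `AntitoneMoment g n`; `le_integral_cell`, `integral_cell_le` (one cell).
* `wZ`, `denZ`, `sumsZ`, `sumsZ_sound` (the integer fold and its invariant); `Encl` (the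
  enclosure `l/D ≤ ∫_{i/q}^{(i+len)/q} tⁿ g ≤ u/D`); `sumsZ₃`, `checkBlock₃`,
  `encl_of_checkBlock₃ : checkBlock₃ … = true → Encl … n₁ … ∧ Encl … n₂ … ∧ Encl … n₃ …`.
* `ChunkBounds`, `bounds_of_chunkBounds` (chains of chunks); `integral_add_adjacent`,
  `integral_Ioi_eq_add`, `le_integral_Ioi`, `integral_Ioi_le_add` (gluing, improper integral).

NOT here: any particular density or certificate (oracle, tail bound and kernel cells live with their
users); higher-order (trapezoid / chord–tangent) rules.

## References

* R. E. Moore, *Interval Analysis*, Prentice-Hall 1966, Ch. 3 and §8.1 (inclusion property;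
  interval integration of monotone integrands by endpoint values) — the method is its routine
  application. [folklore]
-/

open Real Set MeasureTheory

namespace Literature.Analysis.ValidatedNumerics.MonotoneQuadrature

open NumericsMP

/-! ## The one-cell inequalities -/

/-- The exact weight `∫_a^b tⁿ dt = (b^{n+1} − a^{n+1})/(n+1)`. [folklore] -/
noncomputable def cellWeight (n : ℕ) (a b : ℝ) : ℝ := (b ^ (n + 1) - a ^ (n + 1)) / (n + 1)

/-- `∫_a^b tⁿ · c dt = c · cellWeight n a b`. [folklore] -/
theorem integral_pow_mul_const (n : ℕ) (a b c : ℝ) :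
    ∫ t in a..b, t ^ n * c = c * cellWeight n a b := by
  rw [intervalIntegral.integral_mul_const, integral_pow, cellWeight]; ring

/-- The weight of a cell `0 ≤ a ≤ b` is nonnegative. [folklore] -/
theorem cellWeight_nonneg (n : ℕ) {a b : ℝ} (ha : 0 ≤ a) (hab : a ≤ b) : 0 ≤ cellWeight n a b :=
  div_nonneg (sub_nonneg.2 (pow_le_pow_left₀ ha hab _)) (by positivity)

/-- The hypotheses of the method: `g` is antitone and nonnegative on `[0, ∞)` and `t ↦ tⁿ g(t)` is
integrable on `(0, ∞)`. [folklore] -/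
structure AntitoneMoment (g : ℝ → ℝ) (n : ℕ) : Prop where
  anti : AntitoneOn g (Ici 0)
  nonneg : ∀ t, 0 ≤ t → 0 ≤ g t
  integrable : IntegrableOn (fun t => t ^ n * g t) (Ioi 0)

namespace AntitoneMoment

variable {g : ℝ → ℝ} {n : ℕ}

/-- The moment integrand is interval-integrable on every cell of `[0, ∞)`. [folklore] -/
theorem intervalIntegrable_cell (h : AntitoneMoment g n) {a b : ℝ} (ha : 0 ≤ a) (hab : a ≤ b) :
    IntervalIntegrable (fun t => t ^ n * g t) volume a b := by
  rw [intervalIntegrable_iff_integrableOn_Ioc_of_le hab]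
  exact h.integrable.mono_set fun t ht => lt_of_le_of_lt ha ht.1

/-- Lower one-cell inequality: `ℓ ≤ g(b)` gives `ℓ · ∫_a^b tⁿ ≤ ∫_a^b tⁿ g`. [folklore] -/
theorem le_integral_cell (h : AntitoneMoment g n) {a b ℓ : ℝ} (ha : 0 ≤ a) (hab : a ≤ b)
    (hℓ : ℓ ≤ g b) : ℓ * cellWeight n a b ≤ ∫ t in a..b, t ^ n * g t := by
  have hW := cellWeight_nonneg n ha hab
  calc ℓ * cellWeight n a b ≤ g b * cellWeight n a b := mul_le_mul_of_nonneg_right hℓ hW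
    _ = ∫ t in a..b, t ^ n * g b := (integral_pow_mul_const n a b (g b)).symm
    _ ≤ ∫ t in a..b, t ^ n * g t := by
        apply intervalIntegral.integral_mono_on hab
          (((continuous_pow n).mul continuous_const).intervalIntegrable _ _)
          (h.intervalIntegrable_cell ha hab)
        intro t ht
        have ht0 : (0 : ℝ) ≤ t := ha.trans ht.1
        exact mul_le_mul_of_nonneg_left
          (h.anti (show t ∈ Ici (0 : ℝ) from ht0) (show b ∈ Ici (0 : ℝ) from ha.trans hab) ht.2)
          (pow_nonneg ht0 n)

/-- Upper one-cell inequality: `g(a) ≤ u` gives `∫_a^b tⁿ g ≤ u · ∫_a^b tⁿ`. [folklore] -/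
theorem integral_cell_le (h : AntitoneMoment g n) {a b u : ℝ} (ha : 0 ≤ a) (hab : a ≤ b)
    (hu : g a ≤ u) : ∫ t in a..b, t ^ n * g t ≤ u * cellWeight n a b := by
  have hW := cellWeight_nonneg n ha hab
  calc ∫ t in a..b, t ^ n * g t ≤ ∫ t in a..b, t ^ n * g a := by
        apply intervalIntegral.integral_mono_on hab (h.intervalIntegrable_cell ha hab)
          (((continuous_pow n).mul continuous_const).intervalIntegrable _ _)
        intro t ht
        have ht0 : (0 : ℝ) ≤ t := ha.trans ht.1
        exact mul_le_mul_of_nonneg_left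
          (h.anti (show a ∈ Ici (0 : ℝ) from ha) (show t ∈ Ici (0 : ℝ) from ht0) ht.1)
          (pow_nonneg ht0 n)
    _ = g a * cellWeight n a b := integral_pow_mul_const n a b (g a)
    _ ≤ u * cellWeight n a b := mul_le_mul_of_nonneg_right hu hW

/-! ## Gluing: adjacent blocks, and the improper integral from a tail bound -/

/-- `∫_a^b + ∫_b^c = ∫_a^c` on `[0, ∞)` (integrability discharged). [folklore] -/
theorem integral_add_adjacent (h : AntitoneMoment g n) {a b c : ℝ} (ha : 0 ≤ a) (hab : a ≤ b)
    (hbc : b ≤ c) :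
    (∫ t in a..b, t ^ n * g t) + ∫ t in b..c, t ^ n * g t = ∫ t in a..c, t ^ n * g t :=
  intervalIntegral.integral_add_adjacent_intervals (h.intervalIntegrable_cell ha hab)
    (h.intervalIntegrable_cell (ha.trans hab) hbc)

/-- `∫_{(0,∞)} = ∫_0^T + ∫_{(T,∞)}`. [folklore] -/
theorem integral_Ioi_eq_add (h : AntitoneMoment g n) {T : ℝ} (hT : 0 ≤ T) :
    ∫ t in Ioi 0, t ^ n * g t = (∫ t in (0 : ℝ)..T, t ^ n * g t) + ∫ t in Ioi T, t ^ n * g t :=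
  (intervalIntegral.integral_interval_add_Ioi h.integrable
    (h.integrable.mono_set (Ioi_subset_Ioi hT))).symm

/-- A lower bound for `∫_0^T` is one for `∫_{(0,∞)}`: the tail is nonnegative. [folklore] -/
theorem le_integral_Ioi (h : AntitoneMoment g n) {T L : ℝ} (hT : 0 ≤ T)
    (hL : L ≤ ∫ t in (0 : ℝ)..T, t ^ n * g t) : L ≤ ∫ t in Ioi 0, t ^ n * g t := by
  rw [h.integral_Ioi_eq_add hT]
  have : 0 ≤ ∫ t in Ioi T, t ^ n * g t := setIntegral_nonneg measurableSet_Ioi fun t ht =>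
    mul_nonneg (pow_nonneg (hT.trans (le_of_lt ht)) n) (h.nonneg t (hT.trans (le_of_lt ht)))
  linarith

/-- An upper bound for `∫_0^T` plus a tail bound is an upper bound for `∫_{(0,∞)}`. [folklore] -/
theorem integral_Ioi_le_add (h : AntitoneMoment g n) {T U τ : ℝ} (hT : 0 ≤ T)
    (hU : ∫ t in (0 : ℝ)..T, t ^ n * g t ≤ U) (hτ : ∫ t in Ioi T, t ^ n * g t ≤ τ) :
    ∫ t in Ioi 0, t ^ n * g t ≤ U + τ := by
  rw [h.integral_Ioi_eq_add hT]
  linarith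

end AntitoneMoment

/-! ## Integer Riemann sums from an enclosure oracle -/

/-- The integer cell weight `(i+1)^{n+1} − i^{n+1}`
(`= q^{n+1} (n+1) · cellWeight n (i/q) ((i+1)/q)`). [folklore] -/
def wZ (n i : ℕ) : ℤ := ((i : ℤ) + 1) ^ (n + 1) - (i : ℤ) ^ (n + 1)

/-- The common denominator `S · q^{n+1} · (n+1)` of the integer Riemann sums. [folklore] -/
def denZ (S q n : ℕ) : ℕ := S * q ^ (n + 1) * (n + 1)

/-- ONE PASS of the oracle over the cells `[j/q, (j+1)/q]`, `i ≤ j < i + len` (structural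
recursion on `len`, accumulator style — no intermediate list): returns the enclosure of the last
point `g((i+len)/q)` together with the integer lower sum `Σ lo_{j+1} · wZ n j` (right endpoints,
`g` antitone) and upper sum `Σ hi_j · wZ n j` (left endpoints); `none` if the oracle fails
somewhere. [folklore] -/
def sumsZ (enc : ℕ → Option MI) (n i : ℕ) : ℕ → Option (MI × ℤ × ℤ)
  | 0 =>
    match enc i with
    | some E => some (E, 0, 0)
    | none => none
  | len + 1 =>
    match sumsZ enc n i len, enc (i + len + 1) with
    | some (E, sl, su), some E' =>
      some (E', sl + E'.lo * wZ n (i + len), su + E.hi * wZ n (i + len))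
    | _, _ => none

section Soundness

variable {S q n : ℕ} {g : ℝ → ℝ}

/-- The integer weight is the scaled real weight:
`wZ n i = q^{n+1} (n+1) · cellWeight n (i/q) ((i+1)/q)`. [folklore] -/
theorem wZ_eq (hq : 0 < q) (n i : ℕ) :
    (wZ n i : ℝ)
      = (q : ℝ) ^ (n + 1) * (n + 1) * cellWeight n ((i : ℝ) / q) (((i : ℝ) + 1) / q) := by
  have hq' : (q : ℝ) ≠ 0 := by positivity
  have hn : (n : ℝ) + 1 ≠ 0 := by positivity
  unfold wZ cellWeight
  push_cast
  rw [div_pow, div_pow]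
  field_simp

/-- Soundness invariant of `sumsZ` for a sound oracle: after `len` cells the carried enclosure is
that of `g((i+len)/q)` and the two integer sums bracket `denZ · ∫_{i/q}^{(i+len)/q} tⁿ g`.
[folklore] -/
theorem sumsZ_sound (h : AntitoneMoment g n) (hS : 0 < S) (hq : 0 < q) {enc : ℕ → Option MI}
    (henc : ∀ i E, enc i = some E → MI.mem S (g ((i : ℝ) / q)) E) (i : ℕ) :
    ∀ (len : ℕ) {E : MI} {sl su : ℤ}, sumsZ enc n i len = some (E, sl, su) →
      MI.mem S (g (((i : ℝ) + len) / q)) E ∧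
        (sl : ℝ) ≤ (denZ S q n : ℝ) * ∫ t in ((i : ℝ) / q)..(((i : ℝ) + len) / q), t ^ n * g t ∧
        (denZ S q n : ℝ) * ∫ t in ((i : ℝ) / q)..(((i : ℝ) + len) / q), t ^ n * g t ≤ (su : ℝ)
  | 0, E, sl, su, hs => by
    simp only [sumsZ] at hs
    split at hs
    · rename_i E₀ hE₀
      simp only [Option.some.injEq, Prod.mk.injEq] at hs
      obtain ⟨rfl, rfl, rfl⟩ := hs
      refine ⟨by simpa using henc i _ hE₀, ?_, ?_⟩ <;> simp
    · simp at hs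
  | len + 1, E, sl, su, hs => by
    simp only [sumsZ] at hs
    split at hs
    · rename_i E₁ sl₁ su₁ E' hrec hE'
      simp only [Option.some.injEq, Prod.mk.injEq] at hs
      obtain ⟨rfl, rfl, rfl⟩ := hs
      obtain ⟨hmem, hlo, hhi⟩ := sumsZ_sound h hS hq henc i len hrec
      have hmem' : MI.mem S (g (((i : ℝ) + len + 1) / q)) E' := by
        have := henc _ _ hE'
        push_cast at this
        exact this
      have h0 : (0 : ℝ) ≤ (i : ℝ) / q := by positivity
      have ha : (0 : ℝ) ≤ ((i : ℝ) + len) / q := by positivity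
      have hab : ((i : ℝ) + len) / q ≤ ((i : ℝ) + len + 1) / q :=
        div_le_div_of_nonneg_right (by linarith) (by positivity)
      have h0a : (i : ℝ) / q ≤ ((i : ℝ) + len) / q :=
        div_le_div_of_nonneg_right (by linarith) (by positivity)
      -- the new cell `[(i+len)/q, (i+len+1)/q]`
      have hcl := h.le_integral_cell ha hab (MI.lo_div_le hS hmem')
      have hcu := h.integral_cell_le ha hab (MI.le_hi_div hS hmem)
      have hw : (wZ n (i + len) : ℝ) = (q : ℝ) ^ (n + 1) * (n + 1)
          * cellWeight n (((i : ℝ) + len) / q) (((i : ℝ) + len + 1) / q) := by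
        rw [wZ_eq hq]; push_cast; ring_nf
      have key : ∀ x : ℝ, x * (wZ n (i + len) : ℝ) = (denZ S q n : ℝ)
          * (x / S * cellWeight n (((i : ℝ) + len) / q) (((i : ℝ) + len + 1) / q)) := by
        intro x; rw [hw, denZ]; push_cast; field_simp
      have hden : (0 : ℝ) ≤ (denZ S q n : ℝ) := by positivity
      have hlo' := mul_le_mul_of_nonneg_left hcl hden
      have hhi' := mul_le_mul_of_nonneg_left hcu hden
      rw [← key] at hlo' hhi'
      have hsplit := h.integral_add_adjacent h0 h0a hab
      refine ⟨?_, ?_, ?_⟩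
      · push_cast
        rw [show (i : ℝ) + (len + 1) = i + len + 1 by ring]
        exact hmem'
      · push_cast
        rw [show (i : ℝ) + (len + 1) = i + len + 1 by ring, ← hsplit, mul_add]
        linarith
      · push_cast
        rw [show (i : ℝ) + (len + 1) = i + len + 1 by ring, ← hsplit, mul_add]
        linarith
    · simp at hs

/-! ## Enclosures from the sums; three exponents in one pass; the Boolean checker -/

/-- The rational enclosure `l/D ≤ ∫_{i/q}^{(i+len)/q} tⁿ g ≤ u/D` (the shape every certificate
produces). [folklore] -/
def Encl (g : ℝ → ℝ) (q D i len n : ℕ) (l u : ℤ) : Prop :=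
  (l : ℝ) / D ≤ ∫ t in ((i : ℝ) / q)..(((i : ℝ) + len) / q), t ^ n * g t ∧
    ∫ t in ((i : ℝ) / q)..(((i : ℝ) + len) / q), t ^ n * g t ≤ (u : ℝ) / D

/-- From the integer sums and two integer comparisons to the enclosure `Encl`. [folklore] -/
theorem encl_of_sums (h : AntitoneMoment g n) (hS : 0 < S) (hq : 0 < q) {D : ℕ} (hD : 0 < D)
    {enc : ℕ → Option MI} (henc : ∀ i E, enc i = some E → MI.mem S (g ((i : ℝ) / q)) E)
    {i len : ℕ} {E : MI} {sl su l u : ℤ} (hs : sumsZ enc n i len = some (E, sl, su))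
    (h1 : l * (denZ S q n : ℤ) ≤ sl * D) (h2 : su * D ≤ u * (denZ S q n : ℤ)) :
    Encl g q D i len n l u := by
  have h1' : (l : ℝ) * (denZ S q n : ℝ) ≤ (sl : ℝ) * D := by exact_mod_cast h1
  have h2' : (su : ℝ) * D ≤ (u : ℝ) * (denZ S q n : ℝ) := by exact_mod_cast h2
  have hden : (0 : ℝ) < (denZ S q n : ℝ) := by
    have : 0 < denZ S q n := by unfold denZ; positivity
    exact_mod_cast this
  have hDr : (0 : ℝ) < D := by exact_mod_cast hD
  obtain ⟨-, hlo, hhi⟩ := sumsZ_sound h hS hq henc i len hs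
  constructor
  · rw [div_le_iff₀ hDr]
    nlinarith [mul_le_mul_of_nonneg_right hlo hDr.le]
  · rw [le_div_iff₀ hDr]
    nlinarith [mul_le_mul_of_nonneg_right hhi hDr.le]

end Soundness

/-- ONE PASS for THREE exponents `n₁ n₂ n₃` (the point enclosures are shared): the last point
enclosure and the three `(lower, upper)` integer sums. [folklore] -/
def sumsZ₃ (enc : ℕ → Option MI) (n₁ n₂ n₃ i : ℕ) :
    ℕ → Option (MI × (ℤ × ℤ) × (ℤ × ℤ) × (ℤ × ℤ))
  | 0 =>
    match enc i with
    | some E => some (E, (0, 0), (0, 0), (0, 0))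
    | none => none
  | len + 1 =>
    match sumsZ₃ enc n₁ n₂ n₃ i len, enc (i + len + 1) with
    | some (E, (l₁, u₁), (l₂, u₂), (l₃, u₃)), some E' =>
      some (E', (l₁ + E'.lo * wZ n₁ (i + len), u₁ + E.hi * wZ n₁ (i + len)),
        (l₂ + E'.lo * wZ n₂ (i + len), u₂ + E.hi * wZ n₂ (i + len)),
        (l₃ + E'.lo * wZ n₃ (i + len), u₃ + E.hi * wZ n₃ (i + len)))
    | _, _ => none

/-- The three-exponent pass projects onto three single passes. [folklore] -/
theorem sumsZ₃_proj (enc : ℕ → Option MI) (n₁ n₂ n₃ i : ℕ) :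
    ∀ (len : ℕ) {E : MI} {a b c : ℤ × ℤ}, sumsZ₃ enc n₁ n₂ n₃ i len = some (E, a, b, c) →
      sumsZ enc n₁ i len = some (E, a) ∧ sumsZ enc n₂ i len = some (E, b) ∧
        sumsZ enc n₃ i len = some (E, c)
  | 0, E, a, b, c, hs => by
    simp only [sumsZ₃] at hs
    split at hs
    · rename_i E₀ hE₀
      simp only [Option.some.injEq, Prod.mk.injEq] at hs
      obtain ⟨rfl, rfl, rfl, rfl⟩ := hs
      simp [sumsZ, hE₀]
    · simp at hs
  | len + 1, E, a, b, c, hs => by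
    simp only [sumsZ₃] at hs
    split at hs
    · rename_i E₁ l₁ u₁ l₂ u₂ l₃ u₃ E' hrec hE'
      simp only [Option.some.injEq, Prod.mk.injEq] at hs
      obtain ⟨rfl, rfl, rfl, rfl⟩ := hs
      obtain ⟨r₁, r₂, r₃⟩ := sumsZ₃_proj enc n₁ n₂ n₃ i len hrec
      simp [sumsZ, r₁, r₂, r₃, hE']
    · simp at hs

/-- The two integer comparisons `l · den ≤ sl · D` and `su · D ≤ u · den`. [folklore] -/
def cmpZ (den D : ℕ) (l u sl su : ℤ) : Bool :=
  decide (l * (den : ℤ) ≤ sl * D) && decide (su * D ≤ u * (den : ℤ))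

/-- Boolean checker for three claims `(nⱼ, lⱼ, uⱼ)` = "`lⱼ/D ≤ ∫_{i/q}^{(i+len)/q} t^{nⱼ} g ≤ uⱼ/D`"
over one block, from ONE oracle pass. [folklore] -/
def checkBlock₃ (enc : ℕ → Option MI) (S q D i len : ℕ) (c₁ c₂ c₃ : ℕ × ℤ × ℤ) : Bool :=
  match sumsZ₃ enc c₁.1 c₂.1 c₃.1 i len with
  | some (_, (sl₁, su₁), (sl₂, su₂), (sl₃, su₃)) =>
    cmpZ (denZ S q c₁.1) D c₁.2.1 c₁.2.2 sl₁ su₁ && cmpZ (denZ S q c₂.1) D c₂.2.1 c₂.2.2 sl₂ su₂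
      && cmpZ (denZ S q c₃.1) D c₃.2.1 c₃.2.2 sl₃ su₃
  | none => false

/-- SOUNDNESS of the checker for a sound oracle: `checkBlock₃ … = true` gives the three enclosures;
the positivity side conditions are closed Boolean equations too (`rfl`). [folklore] -/
theorem encl_of_checkBlock₃ {S q D : ℕ} {g : ℝ → ℝ} {enc : ℕ → Option MI}
    (henc : ∀ i E, enc i = some E → MI.mem S (g ((i : ℝ) / q)) E) (hS : Nat.blt 0 S = true)
    (hq : Nat.blt 0 q = true) (hD : Nat.blt 0 D = true) {i len n₁ n₂ n₃ : ℕ}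
    {l₁ u₁ l₂ u₂ l₃ u₃ : ℤ} (h₁ : AntitoneMoment g n₁) (h₂ : AntitoneMoment g n₂)
    (h₃ : AntitoneMoment g n₃)
    (hc : checkBlock₃ enc S q D i len (n₁, l₁, u₁) (n₂, l₂, u₂) (n₃, l₃, u₃) = true) :
    Encl g q D i len n₁ l₁ u₁ ∧ Encl g q D i len n₂ l₂ u₂ ∧ Encl g q D i len n₃ l₃ u₃ := by
  have hS' : 0 < S := by simpa using hS
  have hq' : 0 < q := by simpa using hq
  have hD' : 0 < D := by simpa using hD
  unfold checkBlock₃ at hc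
  split at hc
  · rename_i E sl₁ su₁ sl₂ su₂ sl₃ su₃ hs
    simp only [cmpZ, Bool.and_eq_true, decide_eq_true_eq] at hc
    obtain ⟨⟨⟨a₁, b₁⟩, a₂, b₂⟩, a₃, b₃⟩ := hc
    obtain ⟨r₁, r₂, r₃⟩ := sumsZ₃_proj enc n₁ n₂ n₃ i len hs
    exact ⟨encl_of_sums h₁ hS' hq' hD' henc r₁ a₁ b₁, encl_of_sums h₂ hS' hq' hD' henc r₂ a₂ b₂,
      encl_of_sums h₃ hS' hq' hD' henc r₃ a₃ b₃⟩
  · simp at hc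

/-! ## Chains of chunks

A long block is certified as a chain of shorter chunks (one kernel cell each, so that a single
kernel evaluation stays short); `ChunkBounds` is the conjunction of the per-chunk enclosures and
`bounds_of_chunkBounds` adds them up. -/

/-- The conjunction of the chunk enclosures `Encl g q D (i + j·len) len n l_j u_j` for a list of
claimed pairs `(l_j, u_j)`. [folklore] -/
def ChunkBounds (g : ℝ → ℝ) (q n len D : ℕ) : ℕ → List (ℤ × ℤ) → Prop
  | _, [] => True
  | i, lu :: rest => Encl g q D i len n lu.1 lu.2 ∧ ChunkBounds g q n len D (i + len) rest

/-- Adding up a chain of chunk enclosures: `(Σ l_j)/D ≤ ∫_{i/q}^{(i + len·|L|)/q} tⁿ g ≤ (Σ u_j)/D`.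
[folklore] -/
theorem bounds_of_chunkBounds {q n : ℕ} {g : ℝ → ℝ} (h : AntitoneMoment g n) (hq : 0 < q)
    (len D : ℕ) :
    ∀ (L : List (ℤ × ℤ)) (i : ℕ), ChunkBounds g q n len D i L →
      (((L.map Prod.fst).sum : ℤ) : ℝ) / D
          ≤ ∫ t in ((i : ℝ) / q)..(((i : ℝ) + (len : ℝ) * ((L.length : ℕ) : ℝ)) / q), t ^ n * g t ∧
        ∫ t in ((i : ℝ) / q)..(((i : ℝ) + (len : ℝ) * ((L.length : ℕ) : ℝ)) / q), t ^ n * g t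
          ≤ (((L.map Prod.snd).sum : ℤ) : ℝ) / D
  | [], i, _ => by simp
  | lu :: rest, i, hc => by
    obtain ⟨⟨hl, hu⟩, hrest⟩ := hc
    obtain ⟨ihl, ihu⟩ := bounds_of_chunkBounds h hq len D rest (i + len) hrest
    have hlen : (((lu :: rest).length : ℕ) : ℝ) = (rest.length : ℝ) + 1 := by simp
    have hi0 : (0 : ℝ) ≤ (i : ℝ) / q := by positivity
    have hab : (i : ℝ) / q ≤ ((i : ℝ) + len) / q :=
      div_le_div_of_nonneg_right (by linarith [(Nat.cast_nonneg len : (0 : ℝ) ≤ len)])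
        (by positivity)
    have hbc : ((i : ℝ) + len) / q ≤ ((i : ℝ) + (len : ℝ) * ((rest.length : ℝ) + 1)) / q :=
      div_le_div_of_nonneg_right (by nlinarith [(Nat.cast_nonneg len : (0 : ℝ) ≤ len),
        (Nat.cast_nonneg rest.length : (0 : ℝ) ≤ rest.length)]) (by positivity)
    have hsplit := h.integral_add_adjacent hi0 hab hbc
    push_cast at ihl ihu ⊢
    rw [show (i : ℝ) + len + len * (rest.length : ℝ) = i + len * ((rest.length : ℝ) + 1) by ring]
      at ihl ihu
    rw [hlen, ← hsplit]
    simp only [List.map_cons, List.sum_cons]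
    constructor
    · refine le_of_eq_of_le (add_div _ _ _) ?_
      linarith
    · refine le_of_le_of_eq ?_ (add_div _ _ _).symm
      linarith

end Literature.Analysis.ValidatedNumerics.MonotoneQuadrature
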